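import Summits.QuantumFields.YangMills.Theorems.FluctuationComparisonRegPrIntLS2BetaArcBondSplit
import Summits.QuantumFields.YangMills.Theorems.FluctuationComparisonRegPrIntLS2BetaSmallBondGaugeToronObstruction
import HarnessLib

/-!
# S2β · D-GUARD ∕ (BG∞) — NETS FOR SLOW DATA (the `hpatch` supplier of ✓p838857 `exists_forall_le_arc_of_patched` ∕ ✓p839220 `exists_coneCentre_of_patched`
# for the Stage-T rings and Stage-S shells of UV3-NODE §116 ∕ ADD.1): a chain (resp. grid) of `SU(2)` data with per-bond `dist1`-oscillation `≤ δ`, subsampled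
# every `m` steps, is a net: every datum is within arc `(π∕2)·(m−1)·δ` (resp. `(π∕2)·2(m−1)·δ`) of a net point, and the net has `L∕m + 1` (resp.
# `(n₁∕m + 1)(n₂∕m + 1)`) points — a count INDEPENDENT of the data size once `m ∝ L`, which is what makes the cone's cap radius `r` (hence `Λ = (π−r)∕sin r`) absolute

Cell `ym3-torus` (YM ladder rung R3 = continuum `SU(2)` Yang–Mills on the three-torus at fixed lattice data — a RUNG: NOT d = 4, NOT infinite volume,
NOT a mass gap, NOT Clay).  Width seat «width 5» `ym3-torus-px5` (gen 24), FREE px helper on crux `stmt-QuantumFields-20520` (`FluctuationComparisonRegPrIntL`;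
registry `Lines/semiclassical_s2beta.lean` UNTOUCHED, 0∕5); `--kind proof --supports stmt-QuantumFields-20520 --as helper`, count-neutral, DEFINITION-FREE
(0 `def`, 0 `instance`, 0 `notation`, 0 `sorry`, default heartbeats).

WHY.  The cone stages (T2 ✓p839841, S2 ✓∕⧗px8) need a centre `a` with ALL ring∕shell data inside the cap `‖logVec (a⁻¹·datum)‖ ≤ π − r`, and their step constants
carry `Λ = (π − r)∕sin r`; for `step ≤ K∕ρ` with an ABSOLUTE `K` the radius `r` must not depend on `ρ`.  ✓`exists_coneCentre_of_patched (c : ι → SU2) (φ : κ → SU2)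
(hpatch : ∀ k, ∃ i, ‖logVec ((c i)⁻¹·φ k)‖ ≤ r∕2) (hcard : card ι · (2∕(3π))·(3r∕2)³ < 1)` delivers such an `a` from a NET whose cardinality is absolute.  Ring data of a
Stage-T slice are a closed chain of `4n` points with per-bond oscillation `δ ≈ 2π∕ρ + η` (total variation `≈ 34`, absolute); shell data of a Stage-S cube are six
`n × n` grids with per-bond oscillation `≈ K_T∕ρ`.  Subsampling every `m ∝ ρ` steps gives nets of absolute cardinality with patch radius `∝ m·δ` absolute — this file.

WHAT IS PROVED (sorry-free; arc `= ‖logVec (su2Quat ·)‖`, chord→arc by ✓`norm_logVec_le_pi_div_two_mul_dist1`, triangle by ✓`norm_logVec_su2Quat_mul_le`).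
* §1 `dist1_inv_mul_eq` (`dist1 (x⁻¹y) = dist1 (xy⁻¹)`, any gauge group), ★`arc_step_le` (`dist1 (x·y⁻¹) ≤ δ ⟹ arc(x⁻¹y) ≤ (π∕2)δ`).
* §2 CHAINS: ★★`arc_chain_le` (`k + d ≤ L ⟹ arc((φ k)⁻¹ φ (k+d)) ≤ (π∕2)·d·δ`), ★★`arc_patch_chain_le` (net point `φ (m·(k∕m))`: `≤ (π∕2)(m−1)δ`),
  ★★★`exists_patch_of_chain` — `hpatch` currency: `∀ k : Fin (L+1), ∃ i : Fin (L∕m+1), arc((φ (m·i))⁻¹ φ k) ≤ (π∕2)·(m−1)·δ`.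
* §3 GRIDS: ★★`arc_grid_le` (`arc((ψ i k)⁻¹ ψ (i+d) (k+e)) ≤ (π∕2)(d+e)δ`), ★★`arc_patch_grid_le`,
  ★★★`exists_patch_of_grid` — `∀ p : Fin (n₁+1) × Fin (n₂+1), ∃ q : Fin (n₁∕m+1) × Fin (n₂∕m+1), arc ≤ (π∕2)·(2(m−1))·δ`.

HONEST SCOPE.  Elementary metric bookkeeping on `SU(2)`; no lattice, no gauge field; nothing of Bałaban's renormalisation-group analysis is asserted or proved
([Balaban1985RegularSpaces] Thm 2 p.83 — local small gauges — is the consumer's context only).  `hSec` ∕ (BG∞) ∕ `hsupp⁺` are CONJECTURES (plan §116) and NOT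
proved; GAP♯∘ (registry UNTOUCHED), the five registered stubs (0∕5), S2β, 20520, 19936, 19200, `YM3TorusSU2` are NOT proved; no registered stub is closed; rung R3 —
NOT d = 4, NOT infinite volume, NOT a mass gap, NOT Clay; the Yang–Mills mass gap is NOT proved.  Axioms standard.

References: T. Bałaban, CMP **99** (1985) 75–102 [Balaban1985RegularSpaces] (Thm 2 p.83).
-/

set_option autoImplicit false

noncomputable section

namespace Summit.QuantumFields.YangMills.Theorems.FluctuationComparisonRegPrIntLS2BetaSlowDataNets

open scoped Real
open Literature.MathematicalPhysics.QuantumLattice (su2Quat)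
open Literature.MathematicalPhysics.QuantumFieldTheory.Balaban1983to89
open T4CubeChartGnomonic (SU2)
open T4ExpWindowSmallField (logVec)
open Summit.QuantumFields.YangMills.Theorems.FluctuationComparisonRegPrIntLS2BetaArcBondSplit (norm_logVec_su2Quat_mul_le)
open Summit.QuantumFields.YangMills.Theorems.FluctuationComparisonRegPrIntLS2BetaDistributedHolonomySU2 (norm_logVec_le_pi_div_two_mul_dist1)
open Summit.QuantumFields.YangMills.Theorems.FluctuationComparisonRegPrIntLS2BetaSmallBondGaugeToronObstruction (norm_logVec_su2Quat_one)

/-! ## §1 One step: chord letter to arc -/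

/-- `dist1 (x⁻¹·y) = dist1 (x·y⁻¹)` in any gauge group (conjugation and inversion invariance). [folklore] -/
theorem dist1_inv_mul_eq {G : Type*} [GaugeGroup G] (x y : G) : dist1 (x⁻¹ * y) = dist1 (x * y⁻¹) := by
  have h := GaugeGroup.dist1_conj (y * x⁻¹) x⁻¹
  rw [inv_inv, show x⁻¹ * (y * x⁻¹) * x = x⁻¹ * y by group] at h
  rw [h, ← GaugeGroup.dist1_inv (y * x⁻¹), mul_inv_rev, inv_inv]

/-- ★ **ONE STEP**: a chord letter `dist1 (x·y⁻¹) ≤ δ` gives the arc bound `‖logVec (x⁻¹·y)‖ ≤ (π∕2)·δ`. [folklore] -/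
theorem arc_step_le (x y : SU2) {δ : ℝ} (h : dist1 (x * y⁻¹) ≤ δ) : ‖logVec (su2Quat (x⁻¹ * y))‖ ≤ π / 2 * δ := by
  have h1 := norm_logVec_le_pi_div_two_mul_dist1 (x⁻¹ * y)
  rw [dist1_inv_mul_eq] at h1
  exact h1.trans (mul_le_mul_of_nonneg_left h (by positivity))

/-! ## §2 Chains -/

/-- ★★ **ARC ALONG A CHAIN**: per-bond `dist1 ≤ δ` on `{0..L}` gives `‖logVec ((φ k)⁻¹·φ (k+d))‖ ≤ (π∕2)·d·δ` for `k + d ≤ L`. [folklore] -/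
theorem arc_chain_le (φ : ℕ → SU2) (L : ℕ) {δ : ℝ} (hstep : ∀ k, k + 1 ≤ L → dist1 (φ k * (φ (k + 1))⁻¹) ≤ δ) :
    ∀ d k, k + d ≤ L → ‖logVec (su2Quat ((φ k)⁻¹ * φ (k + d)))‖ ≤ π / 2 * ((d : ℝ) * δ) := by
  intro d
  induction d with
  | zero =>
    intro k _
    rw [add_zero, inv_mul_cancel, norm_logVec_su2Quat_one]
    simp
  | succ d ih =>
    intro k hk
    have h1 := ih k (by omega)
    have h2 := arc_step_le (φ (k + d)) (φ (k + d + 1)) (hstep (k + d) (by omega))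
    have hsplit : (φ k)⁻¹ * φ (k + (d + 1)) = ((φ k)⁻¹ * φ (k + d)) * ((φ (k + d))⁻¹ * φ (k + d + 1)) := by
      rw [← add_assoc]; group
    rw [hsplit]
    calc _ ≤ ‖logVec (su2Quat ((φ k)⁻¹ * φ (k + d)))‖ + ‖logVec (su2Quat ((φ (k + d))⁻¹ * φ (k + d + 1)))‖ := norm_logVec_su2Quat_mul_le _ _
      _ ≤ π / 2 * ((d : ℝ) * δ) + π / 2 * δ := add_le_add h1 h2
      _ = π / 2 * (((d + 1 : ℕ) : ℝ) * δ) := by push_cast; ring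

/-- ★★ **THE PATCH OF A CHAIN POINT**: subsampling every `m ≥ 1` steps, the datum `φ k` (`k ≤ L`) is within arc `(π∕2)·(m−1)·δ` of the net point `φ (m·(k∕m))`. [folklore] -/
theorem arc_patch_chain_le (φ : ℕ → SU2) (L : ℕ) {δ : ℝ} (hδ : 0 ≤ δ) (hstep : ∀ k, k + 1 ≤ L → dist1 (φ k * (φ (k + 1))⁻¹) ≤ δ)
    (m : ℕ) (hm : 1 ≤ m) (k : ℕ) (hk : k ≤ L) :
    ‖logVec (su2Quat ((φ (m * (k / m)))⁻¹ * φ k))‖ ≤ π / 2 * (((m - 1 : ℕ) : ℝ) * δ) := by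
  have hdm : k % m ≤ m - 1 := by
    have := Nat.mod_lt k (by omega : 0 < m); omega
  have hk' : m * (k / m) + k % m = k := Nat.div_add_mod k m
  have h := arc_chain_le φ L hstep (k % m) (m * (k / m)) (by omega)
  rw [hk'] at h
  refine h.trans (mul_le_mul_of_nonneg_left (mul_le_mul_of_nonneg_right (by exact_mod_cast hdm) hδ) (by positivity))

/-- ★★★ **THE NET OF A SLOW CHAIN** (`hpatch` currency of ✓`exists_coneCentre_of_patched`, net `c i := φ (m·i)`, `i : Fin (L∕m + 1)`): every datum `φ k`, `k ≤ L`, is within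
arc `(π∕2)·(m−1)·δ` of a net point. [folklore] -/
theorem exists_patch_of_chain (φ : ℕ → SU2) (L : ℕ) {δ : ℝ} (hδ : 0 ≤ δ) (hstep : ∀ k, k + 1 ≤ L → dist1 (φ k * (φ (k + 1))⁻¹) ≤ δ)
    (m : ℕ) (hm : 1 ≤ m) :
    ∀ k : Fin (L + 1), ∃ i : Fin (L / m + 1), ‖logVec (su2Quat ((φ (m * (i : ℕ)))⁻¹ * φ (k : ℕ)))‖ ≤ π / 2 * (((m - 1 : ℕ) : ℝ) * δ) := by
  intro k
  have hk : (k : ℕ) ≤ L := Nat.lt_succ_iff.mp k.isLt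
  exact ⟨⟨(k : ℕ) / m, Nat.lt_succ_of_le (Nat.div_le_div_right hk)⟩, arc_patch_chain_le φ L hδ hstep m hm k hk⟩

/-! ## §3 Grids -/

/-- ★★ **ARC ACROSS A GRID**: per-bond `dist1 ≤ δ` in both directions on `{0..n₁} × {0..n₂}` gives `‖logVec ((ψ i k)⁻¹·ψ (i+d) (k+e))‖ ≤ (π∕2)·(d+e)·δ`. [folklore] -/
theorem arc_grid_le (ψ : ℕ → ℕ → SU2) (n₁ n₂ : ℕ) {δ : ℝ}
    (hH : ∀ i k, i + 1 ≤ n₁ → k ≤ n₂ → dist1 (ψ i k * (ψ (i + 1) k)⁻¹) ≤ δ)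
    (hV : ∀ i k, i ≤ n₁ → k + 1 ≤ n₂ → dist1 (ψ i k * (ψ i (k + 1))⁻¹) ≤ δ)
    (i k d e : ℕ) (hi : i + d ≤ n₁) (hk : k + e ≤ n₂) :
    ‖logVec (su2Quat ((ψ i k)⁻¹ * ψ (i + d) (k + e)))‖ ≤ π / 2 * (((d + e : ℕ) : ℝ) * δ) := by
  have h1 := arc_chain_le (fun i' => ψ i' k) n₁ (fun i' hi' => hH i' k hi' (by omega)) d i hi
  have h2 := arc_chain_le (fun k' => ψ (i + d) k') n₂ (fun k' hk' => hV (i + d) k' hi hk') e k hk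
  have hsplit : (ψ i k)⁻¹ * ψ (i + d) (k + e) = ((ψ i k)⁻¹ * ψ (i + d) k) * ((ψ (i + d) k)⁻¹ * ψ (i + d) (k + e)) := by group
  rw [hsplit]
  calc _ ≤ ‖logVec (su2Quat ((ψ i k)⁻¹ * ψ (i + d) k))‖ + ‖logVec (su2Quat ((ψ (i + d) k)⁻¹ * ψ (i + d) (k + e)))‖ := norm_logVec_su2Quat_mul_le _ _
    _ ≤ π / 2 * ((d : ℝ) * δ) + π / 2 * ((e : ℝ) * δ) := add_le_add h1 h2
    _ = π / 2 * (((d + e : ℕ) : ℝ) * δ) := by push_cast; ring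

/-- ★★ **THE PATCH OF A GRID POINT**: subsampling every `m ≥ 1` steps in both directions, `ψ i k` is within arc `(π∕2)·2(m−1)·δ` of `ψ (m·(i∕m)) (m·(k∕m))`. [folklore] -/
theorem arc_patch_grid_le (ψ : ℕ → ℕ → SU2) (n₁ n₂ : ℕ) {δ : ℝ} (hδ : 0 ≤ δ)
    (hH : ∀ i k, i + 1 ≤ n₁ → k ≤ n₂ → dist1 (ψ i k * (ψ (i + 1) k)⁻¹) ≤ δ)
    (hV : ∀ i k, i ≤ n₁ → k + 1 ≤ n₂ → dist1 (ψ i k * (ψ i (k + 1))⁻¹) ≤ δ)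
    (m : ℕ) (hm : 1 ≤ m) (i k : ℕ) (hi : i ≤ n₁) (hk : k ≤ n₂) :
    ‖logVec (su2Quat ((ψ (m * (i / m)) (m * (k / m)))⁻¹ * ψ i k))‖ ≤ π / 2 * (((2 * (m - 1) : ℕ) : ℝ) * δ) := by
  have hdi : i % m ≤ m - 1 := by
    have := Nat.mod_lt i (by omega : 0 < m); omega
  have hdk : k % m ≤ m - 1 := by
    have := Nat.mod_lt k (by omega : 0 < m); omega
  have hi' : m * (i / m) + i % m = i := Nat.div_add_mod i m
  have hk' : m * (k / m) + k % m = k := Nat.div_add_mod k m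
  have h := arc_grid_le ψ n₁ n₂ hH hV (m * (i / m)) (m * (k / m)) (i % m) (k % m) (by omega) (by omega)
  rw [hi', hk'] at h
  have hde : ((i % m + k % m : ℕ) : ℝ) ≤ ((2 * (m - 1) : ℕ) : ℝ) := by exact_mod_cast (by omega : i % m + k % m ≤ 2 * (m - 1))
  exact h.trans (mul_le_mul_of_nonneg_left (mul_le_mul_of_nonneg_right hde hδ) (by positivity))

/-- ★★★ **THE NET OF A SLOW GRID** (`hpatch` currency, net `c q := ψ (m·q.1) (m·q.2)`, `q : Fin (n₁∕m + 1) × Fin (n₂∕m + 1)`): every datum of the grid is within arc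
`(π∕2)·2(m−1)·δ` of a net point. [folklore] -/
theorem exists_patch_of_grid (ψ : ℕ → ℕ → SU2) (n₁ n₂ : ℕ) {δ : ℝ} (hδ : 0 ≤ δ)
    (hH : ∀ i k, i + 1 ≤ n₁ → k ≤ n₂ → dist1 (ψ i k * (ψ (i + 1) k)⁻¹) ≤ δ)
    (hV : ∀ i k, i ≤ n₁ → k + 1 ≤ n₂ → dist1 (ψ i k * (ψ i (k + 1))⁻¹) ≤ δ)
    (m : ℕ) (hm : 1 ≤ m) :
    ∀ p : Fin (n₁ + 1) × Fin (n₂ + 1), ∃ q : Fin (n₁ / m + 1) × Fin (n₂ / m + 1),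
      ‖logVec (su2Quat ((ψ (m * (q.1 : ℕ)) (m * (q.2 : ℕ)))⁻¹ * ψ (p.1 : ℕ) (p.2 : ℕ)))‖ ≤ π / 2 * (((2 * (m - 1) : ℕ) : ℝ) * δ) := by
  rintro ⟨i, k⟩
  have hi : (i : ℕ) ≤ n₁ := Nat.lt_succ_iff.mp i.isLt
  have hk : (k : ℕ) ≤ n₂ := Nat.lt_succ_iff.mp k.isLt
  exact ⟨(⟨(i : ℕ) / m, Nat.lt_succ_of_le (Nat.div_le_div_right hi)⟩, ⟨(k : ℕ) / m, Nat.lt_succ_of_le (Nat.div_le_div_right hk)⟩),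
    arc_patch_grid_le ψ n₁ n₂ hδ hH hV m hm i k hi hk⟩

end Summit.QuantumFields.YangMills.Theorems.FluctuationComparisonRegPrIntLS2BetaSlowDataNets

end
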